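import Literature.Geometry.Lorentzian.SpacetimeLocalConvergenceRestrict
import Literature.Geometry.Lorentzian.ChartCalculus
import Literature.Geometry.Lorentzian.IsometryProofs
import Literature.Geometry.Lorentzian.BilinPullbackEstimates
import HarnessLib

/-!
# Calculus of the coordinate components `Spacetime.metricInCoords`
(topic `Geometry/Lorentzian`; infrastructure for pointed `Cᵏ_loc` convergence of spacetimes,
`SpacetimeLocalConvergence.lean`, whose module docstring defers exactly these facts: "Convergence
in the preferred charts on compact subsets of their targets is equivalent to `Cᵏ_loc` convergence
in any smooth atlas (chain rule on compact sets; not proved here)")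

For a spacetime `𝓢` and a map `ψ : E4 → 𝓢` (a chart inverse, or a comparison map read in a
chart) the components `𝓢.metricInCoords ψ : E4 → (E4 →L E4 →L ℝ)`, `y ↦ g_{ψ y}(dψ_y ·, dψ_y ·)`,
satisfy:

* `contDiffOn_metricInCoords` — **smoothness**: if `ψ` is `C^∞` (as a map into the manifold) on
  an open set `V`, the components are `C^∞` on `V` (the pullback `ψ^* g` is a smooth section of
  the bundle of bilinear forms, `PseudoRiemannianMetric.contMDiff_pullbackBilin_holds`, O'Neill
  1983, Ch. 3, Lemma 3.35 ff.; read through the identity trivialisation of an open subset of `E4`,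
  `OpensChart.contMDiffAt_bilinSection_iff`).
* `metricInCoords_comp` — **chain rule / tensor transformation law**: for `θ : E4 → E4`,
  `metricInCoords (ψ ∘ θ) y = bilinPullback θ (metricInCoords ψ) y = (metricInCoords ψ)(θ y)(Dθ_y ·, Dθ_y ·)`
  (O'Neill 1983, Ch. 3, Def. 3.9 and p. 58, functoriality of pullback; Mathlib `mfderiv_comp`).
* `coordDeviation_comp_decomposition` — the **two-step deviation identity** behind the diagonal
  lemma for `LocalSubconvergence`: reading a composite comparison map `G ∘ F` in a chart `c` of
  the last space and a chart `c'` of the middle space, with transition `θ = c' ∘ F ∘ c⁻¹`,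
  `(G ∘ F ∘ c⁻¹)^* g_𝓢 − (c⁻¹)^* g_𝓤 = θ^*[(G ∘ c'⁻¹)^* g_𝓢 − (c'⁻¹)^* g_𝓣] + [(F ∘ c⁻¹)^* g_𝓣 − (c⁻¹)^* g_𝓤]`
  pointwise near every point where the maps are differentiable (Petersen 2006, Ch. 10, §3.2).

## References
* [ONeill1983] B. O'Neill, *Semi-Riemannian Geometry*, Academic Press 1983, Ch. 3, Def. 3.9,
  p. 58, Lemma 3.35.
* [Petersen2006] P. Petersen, *Riemannian Geometry*, 2nd ed., GTM 171, Springer 2006, Ch. 10, §3.2.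
-/

noncomputable section

open TopologicalSpace Manifold Filter Topology Set Function
open scoped ContDiff Topology ENNReal

universe u v w

namespace Literature.Geometry.Lorentzian

namespace Spacetime

section Smoothness

variable (𝓢 : Spacetime.{u} 4)

/-- Through the inclusion of an open subset `U ⊆ E4`, the differential of `ψ ∘ Subtype.val` at
`z : U` is the differential of `ψ` at `↑z` (`d(Subtype.val) = id`,
`OpenSubmanifold.mfderiv_subtype_val`). [folklore] -/
theorem mfderiv_comp_subtypeVal_opens {U : Opens E4} {ψ : E4 → 𝓢.carrier} (z : U)
    (hψ : MDifferentiableAt 𝓘(ℝ, E4) (𝓡 4) ψ (z : E4)) :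
    mfderiv 𝓘(ℝ, E4) (𝓡 4) (ψ ∘ (Subtype.val : U → E4)) z =
      mfderiv 𝓘(ℝ, E4) (𝓡 4) ψ (z : E4) := by
  have h := mfderiv_comp z hψ
    (Literature.Geometry.Manifold.OpenSubmanifold.mdifferentiableAt_subtype_val
      (I := 𝓘(ℝ, E4)) (U := U) z)
  have h3 : (mfderiv 𝓘(ℝ, E4) (𝓡 4) ψ (z : E4)).comp
      (mfderiv 𝓘(ℝ, E4) 𝓘(ℝ, E4) (Subtype.val : U → E4) z) =
        mfderiv 𝓘(ℝ, E4) (𝓡 4) ψ (z : E4) := by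
    rw [Literature.Geometry.Manifold.OpenSubmanifold.mfderiv_subtype_val]
    exact ContinuousLinearMap.comp_id _
  exact h.trans h3

/-- On an open subset `U ⊆ E4` on which `ψ` is differentiable, the pullback of the metric along
`ψ ∘ Subtype.val : U → 𝓢` (a section of the bundle of bilinear forms over the open submanifold
`U`) has the components `𝓢.metricInCoords ψ`. [folklore] -/
theorem pullbackBilin_comp_subtypeVal_eq_metricInCoords {U : Opens E4} {ψ : E4 → 𝓢.carrier}
    (z : U) (hψ : MDifferentiableAt 𝓘(ℝ, E4) (𝓡 4) ψ (z : E4)) :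
    (show E4 →L[ℝ] E4 →L[ℝ] ℝ from
      pullbackBilin (I := 𝓡 4) (I' := 𝓘(ℝ, E4)) (ψ ∘ (Subtype.val : U → E4)) 𝓢.metric.val z) =
      𝓢.metricInCoords ψ (z : E4) := by
  have hd := 𝓢.mfderiv_comp_subtypeVal_opens z hψ
  have key : ∀ (S : E4 →L[ℝ] E4) (T : E4 →L[ℝ] E4), S = T → ∀ v w : E4,
      𝓢.metric.val (ψ (z : E4)) (S v) (S w) = 𝓢.metric.val (ψ (z : E4)) (T v) (T w) := by
    rintro S T rfl v w
    rfl
  ext v w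
  exact key _ _ hd v w

/-- **Smoothness of the metric components along a smooth parametrisation.** If
`ψ : E4 → 𝓢` is `C^∞` (into the manifold) on an open set `V ⊆ E4`, then
`y ↦ 𝓢.metricInCoords ψ y = g_{ψ y}(dψ_y ·, dψ_y ·)` is `C^∞` on `V` as a map into the normed space
`E4 →L E4 →L ℝ`: the pullback `ψ^* g` is a `C^∞` section of the bundle of bilinear forms over the
open submanifold `V` (O'Neill 1983, Ch. 3, Lemma 3.35 ff.,
`PseudoRiemannianMetric.contMDiff_pullbackBilin_holds`), and section-smoothness over an open
subset of `E4` is smoothness of the components (`OpensChart.contMDiffAt_bilinSection_iff`).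
[cite: ONeill1983, Ch. 3, Lemma 3.35] -/
theorem contDiffOn_metricInCoords {ψ : E4 → 𝓢.carrier} {V : Set E4} (hV : IsOpen V)
    (hψ : ContMDiffOn 𝓘(ℝ, E4) (𝓡 4) ∞ ψ V) : ContDiffOn ℝ ∞ (𝓢.metricInCoords ψ) V := by
  intro y hy
  let U : Opens E4 := ⟨V, hV⟩
  have hf : ContMDiff 𝓘(ℝ, E4) (𝓡 4) ∞ (ψ ∘ (Subtype.val : U → E4)) :=
    hψ.comp_contMDiff contMDiff_subtype_val fun z ↦ z.2
  have hf' : ContMDiff 𝓘(ℝ, E4) (𝓡 4) ((∞ : ℕ∞ω) + 1) (ψ ∘ (Subtype.val : U → E4)) :=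
    hf.of_le (by exact_mod_cast le_rfl)
  have hsec := PseudoRiemannianMetric.contMDiff_pullbackBilin_holds (I := 𝓡 4) (M := 𝓢.carrier)
    (I' := 𝓘(ℝ, E4)) (N := U) (n := ∞) (ψ ∘ Subtype.val) hf' 𝓢.metric.toPseudoRiemannianMetric
  have hG : ContDiffAt ℝ ∞ (𝓢.metricInCoords ψ) ((⟨y, hy⟩ : U) : E4) := by
    refine (OpensChart.contMDiffAt_bilinSection_iff (⟨y, hy⟩ : U)
      (fun z ↦ pullbackBilin (I := 𝓡 4) (I' := 𝓘(ℝ, E4)) (ψ ∘ Subtype.val) 𝓢.metric.val z)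
      (𝓢.metricInCoords ψ) fun z ↦ ?_).1 (hsec ⟨y, hy⟩)
    have hz : MDifferentiableAt 𝓘(ℝ, E4) (𝓡 4) ψ (z : E4) :=
      ((hψ z z.2).contMDiffAt (hV.mem_nhds z.2)).mdifferentiableAt (by simp)
    exact 𝓢.pullbackBilin_comp_subtypeVal_eq_metricInCoords z hz
  exact hG.contDiffWithinAt

/-- The components in a preferred chart are `C^∞` on the chart target. [folklore] -/
theorem contDiffOn_metricInCoords_chartAt_symm (x : 𝓢.carrier) :
    ContDiffOn ℝ ∞ (𝓢.metricInCoords (chartAt E4 x).symm) (chartAt E4 x).target :=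
  𝓢.contDiffOn_metricInCoords (chartAt E4 x).open_target (contMDiffOn_chart_symm (x := x))

/-- The components of `E^* g_𝓣` in a preferred chart of `𝓢` are `C^∞` on the part of the chart
target parametrising an open set on which the comparison map `E` is `C^∞`. [folklore] -/
theorem contDiffOn_metricInCoords_comp_chartAt_symm {𝓣 : Spacetime.{v} 4} (x : 𝓢.carrier)
    {E : 𝓢.carrier → 𝓣.carrier} {W : Set 𝓢.carrier} (hW : IsOpen W)
    (hE : ContMDiffOn (𝓡 4) (𝓡 4) ∞ E W) :
    ContDiffOn ℝ ∞ (𝓣.metricInCoords (E ∘ (chartAt E4 x).symm))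
      ((chartAt E4 x).target ∩ (chartAt E4 x).symm ⁻¹' W) := by
  refine 𝓣.contDiffOn_metricInCoords
    ((chartAt E4 x).continuousOn_symm.isOpen_inter_preimage (chartAt E4 x).open_target hW) ?_
  exact hE.comp ((contMDiffOn_chart_symm (x := x)).mono inter_subset_left) fun y hy ↦ hy.2

end Smoothness

/-! ### The chain rule for the components -/

section ChainRule

variable (𝓢 : Spacetime.{u} 4)

/-- **Transformation law of the metric components** (chain rule): for `θ : E4 → E4`
differentiable at `y` and `ψ : E4 → 𝓢` differentiable at `θ y`,
`𝓢.metricInCoords (ψ ∘ θ) y = bilinPullback θ (𝓢.metricInCoords ψ) y`, i.e.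
`g(d(ψ∘θ) v, d(ψ∘θ) w) = g(dψ (Dθ v), dψ (Dθ w))` (O'Neill 1983, Ch. 3, p. 58; Mathlib
`mfderiv_comp`, `mfderiv_eq_fderiv`). [cite: ONeill1983, Ch. 3, p. 58] -/
theorem metricInCoords_comp {ψ : E4 → 𝓢.carrier} {θ : E4 → E4} {y : E4}
    (hψ : MDifferentiableAt 𝓘(ℝ, E4) (𝓡 4) ψ (θ y)) (hθ : DifferentiableAt ℝ θ y) :
    𝓢.metricInCoords (ψ ∘ θ) y = bilinPullback θ (𝓢.metricInCoords ψ) y := by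
  have hθ' : MDifferentiableAt 𝓘(ℝ, E4) 𝓘(ℝ, E4) θ y :=
    mdifferentiableAt_iff_differentiableAt.mpr hθ
  have hcomp : mfderiv 𝓘(ℝ, E4) (𝓡 4) (ψ ∘ θ) y =
      (mfderiv 𝓘(ℝ, E4) (𝓡 4) ψ (θ y)).comp (fderiv ℝ θ y) := by
    rw [mfderiv_comp y hψ hθ', mfderiv_eq_fderiv]
    exact rfl
  have key : ∀ (S : E4 →L[ℝ] E4) (T : E4 →L[ℝ] E4), S = T → ∀ v w : E4,
      𝓢.metric.val (ψ (θ y)) (S v) (S w) = 𝓢.metric.val (ψ (θ y)) (T v) (T w) := by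
    rintro S T rfl v w
    rfl
  ext v w
  exact key _ _ hcomp v w

/-- Germ form of the chain rule: if `Ψ` agrees with `ψ ∘ θ` near `y`, then
`𝓢.metricInCoords Ψ y = bilinPullback θ (𝓢.metricInCoords ψ) y`. [cite: ONeill1983, Ch. 3, p. 58] -/
theorem metricInCoords_eq_bilinPullback_of_eventuallyEq {Ψ ψ : E4 → 𝓢.carrier} {θ : E4 → E4}
    {y : E4} (h : Ψ =ᶠ[𝓝 y] ψ ∘ θ) (hψ : MDifferentiableAt 𝓘(ℝ, E4) (𝓡 4) ψ (θ y))
    (hθ : DifferentiableAt ℝ θ y) :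
    𝓢.metricInCoords Ψ y = bilinPullback θ (𝓢.metricInCoords ψ) y :=
  (𝓢.metricInCoords_congr_of_eventuallyEq h).trans (𝓢.metricInCoords_comp hψ hθ)

end ChainRule

/-! ### Reading a composite comparison map in two charts -/

section TwoCharts

variable {𝓢 : Spacetime.{u} 4} {𝓣 : Spacetime.{v} 4} {𝓤 : Spacetime.{w} 4}

/-- The **transition map** of a comparison map `F : 𝓤 → 𝓣` between the preferred chart of `𝓤` at
`x` and the preferred chart of `𝓣` at `x'`: `θ = c' ∘ F ∘ c⁻¹ : E4 → E4` (total; meaningful where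
`c⁻¹` lands in the domain of `F` and `F` in the source of `c'`). [cite: Petersen2006, Ch. 10 §3.2] -/
def chartTransition (F : 𝓤.carrier → 𝓣.carrier) (x : 𝓤.carrier) (x' : 𝓣.carrier) : E4 → E4 :=
  chartAt E4 x' ∘ F ∘ (chartAt E4 x).symm

/-- Unfolding `chartTransition`. [folklore] -/
theorem chartTransition_apply (F : 𝓤.carrier → 𝓣.carrier) (x : 𝓤.carrier) (x' : 𝓣.carrier)
    (y : E4) : chartTransition F x x' y = chartAt E4 x' (F ((chartAt E4 x).symm y)) := rfl

/-- The **good set** of the transition: points `y` of the chart target of `𝓤` at `x` whose image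
`c⁻¹ y` lies in the open set `W` (where `F` is smooth) and is mapped by `F` into the chart source
of `𝓣` at `x'`. [folklore] -/
def transitionDomain (F : 𝓤.carrier → 𝓣.carrier) (W : Set 𝓤.carrier) (x : 𝓤.carrier)
    (x' : 𝓣.carrier) : Set E4 :=
  (chartAt E4 x).target ∩ (chartAt E4 x).symm ⁻¹' (W ∩ F ⁻¹' (chartAt E4 x').source)

/-- Membership in the good set. [folklore] -/
theorem mem_transitionDomain {F : 𝓤.carrier → 𝓣.carrier} {W : Set 𝓤.carrier} {x : 𝓤.carrier}
    {x' : 𝓣.carrier} {y : E4} :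
    y ∈ transitionDomain F W x x' ↔ y ∈ (chartAt E4 x).target ∧ (chartAt E4 x).symm y ∈ W ∧
      F ((chartAt E4 x).symm y) ∈ (chartAt E4 x').source := by
  simp [transitionDomain]

/-- The good set is open when `W` is open and `F` is continuous on `W`. [folklore] -/
theorem isOpen_transitionDomain {F : 𝓤.carrier → 𝓣.carrier} {W : Set 𝓤.carrier} (hW : IsOpen W)
    (hF : ContinuousOn F W) (x : 𝓤.carrier) (x' : 𝓣.carrier) :
    IsOpen (transitionDomain F W x x') :=
  (chartAt E4 x).continuousOn_symm.isOpen_inter_preimage (chartAt E4 x).open_target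
    (hF.isOpen_inter_preimage hW (chartAt E4 x').open_source)

/-- **The transition map is `C^∞` on the good set** (charts are `C^∞`, `F` is `C^∞` on `W`).
[cite: Petersen2006, Ch. 10 §3.2] -/
theorem contDiffOn_chartTransition {F : 𝓤.carrier → 𝓣.carrier} {W : Set 𝓤.carrier}
    (hF : ContMDiffOn (𝓡 4) (𝓡 4) ∞ F W) (x : 𝓤.carrier) (x' : 𝓣.carrier) :
    ContDiffOn ℝ ∞ (chartTransition F x x') (transitionDomain F W x x') := by
  rw [← contMDiffOn_iff_contDiffOn]
  have h1 : ContMDiffOn 𝓘(ℝ, E4) (𝓡 4) ∞ (chartAt E4 x).symm (transitionDomain F W x x') :=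
    (contMDiffOn_chart_symm (x := x)).mono inter_subset_left
  have h2 : ContMDiffOn 𝓘(ℝ, E4) (𝓡 4) ∞ (F ∘ (chartAt E4 x).symm) (transitionDomain F W x x') :=
    hF.comp h1 fun y hy ↦ (mem_transitionDomain.1 hy).2.1
  exact (contMDiffOn_chart (x := x')).comp h2 fun y hy ↦ (mem_transitionDomain.1 hy).2.2

/-- The transition map is differentiable at every point of the good set (given differentiability
of `F` there). [folklore] -/
theorem differentiableAt_chartTransition {F : 𝓤.carrier → 𝓣.carrier} {x : 𝓤.carrier}
    {x' : 𝓣.carrier} {y : E4} (hy : y ∈ (chartAt E4 x).target)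
    (hF : MDifferentiableAt (𝓡 4) (𝓡 4) F ((chartAt E4 x).symm y))
    (hy' : F ((chartAt E4 x).symm y) ∈ (chartAt E4 x').source) :
    DifferentiableAt ℝ (chartTransition F x x') y := by
  rw [← mdifferentiableAt_iff_differentiableAt]
  have h1 : MDifferentiableAt 𝓘(ℝ, E4) (𝓡 4) (chartAt E4 x).symm y :=
    mdifferentiableAt_atlas_symm (chart_mem_atlas E4 x) hy
  have h2 : MDifferentiableAt (𝓡 4) 𝓘(ℝ, E4) (chartAt E4 x') (F ((chartAt E4 x).symm y)) :=
    mdifferentiableAt_atlas (chart_mem_atlas E4 x') hy'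
  exact h2.comp y (hF.comp y h1)

/-- Near a point of the good set, `F ∘ c⁻¹ = c'⁻¹ ∘ θ` (the chart `c'` is inverted on its source).
[folklore] -/
theorem comp_symm_eventuallyEq_symm_comp_chartTransition {F : 𝓤.carrier → 𝓣.carrier}
    {x : 𝓤.carrier} {x' : 𝓣.carrier} {y : E4} (hy : y ∈ (chartAt E4 x).target)
    (hF : ContinuousAt F ((chartAt E4 x).symm y))
    (hy' : F ((chartAt E4 x).symm y) ∈ (chartAt E4 x').source) :
    F ∘ (chartAt E4 x).symm =ᶠ[𝓝 y] (chartAt E4 x').symm ∘ chartTransition F x x' := by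
  have hc : ContinuousAt (F ∘ (chartAt E4 x).symm) y :=
    hF.comp ((chartAt E4 x).continuousAt_symm hy)
  have hev : ∀ᶠ y' in 𝓝 y, F ((chartAt E4 x).symm y') ∈ (chartAt E4 x').source :=
    hc.preimage_mem_nhds ((chartAt E4 x').open_source.mem_nhds hy')
  filter_upwards [hev] with y' hy'
  simp only [comp_apply, chartTransition_apply]
  exact ((chartAt E4 x').left_inv hy').symm

/-- Near a point of the good set, `G ∘ F ∘ c⁻¹ = (G ∘ c'⁻¹) ∘ θ`. [folklore] -/
theorem comp_comp_symm_eventuallyEq {G : 𝓣.carrier → 𝓢.carrier} {F : 𝓤.carrier → 𝓣.carrier}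
    {x : 𝓤.carrier} {x' : 𝓣.carrier} {y : E4} (hy : y ∈ (chartAt E4 x).target)
    (hF : ContinuousAt F ((chartAt E4 x).symm y))
    (hy' : F ((chartAt E4 x).symm y) ∈ (chartAt E4 x').source) :
    (G ∘ F) ∘ (chartAt E4 x).symm =ᶠ[𝓝 y] (G ∘ (chartAt E4 x').symm) ∘ chartTransition F x x' := by
  filter_upwards [comp_symm_eventuallyEq_symm_comp_chartTransition hy hF hy'] with y' hy'
  simp only [comp_apply] at hy' ⊢
  rw [hy']

/-- **The two-step deviation identity.** Let `F : 𝓤 → 𝓣` and `G : 𝓣 → 𝓢` be comparison maps,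
`c = chartAt E4 x` a chart of `𝓤`, `c' = chartAt E4 x'` a chart of `𝓣`, `θ = c' ∘ F ∘ c⁻¹`, and let
`y ∈ c.target` with `F` differentiable at `c⁻¹ y`, `F(c⁻¹ y) ∈ c'.source` and `G` differentiable at
`F(c⁻¹ y)`. Then the deviation of the composite `G ∘ F` from `𝓤` in the chart `c` splits as
`(G∘F∘c⁻¹)^* g_𝓢 − (c⁻¹)^* g_𝓤 = θ^*[(G∘c'⁻¹)^* g_𝓢 − (c'⁻¹)^* g_𝓣] + [(F∘c⁻¹)^* g_𝓣 − (c⁻¹)^* g_𝓤]`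
at `y` — the deviation of `G` in the chart `c'`, transported by the transition map, plus the
deviation of `F` in the chart `c` (Petersen 2006, Ch. 10, §3.2; the identity behind "limits of
limits are limits"). [cite: Petersen2006, Ch. 10 §3.2] -/
theorem metricInCoords_comp_comp_sub_eq {G : 𝓣.carrier → 𝓢.carrier}
    {F : 𝓤.carrier → 𝓣.carrier} {x : 𝓤.carrier} {x' : 𝓣.carrier} {y : E4}
    (hy : y ∈ (chartAt E4 x).target)
    (hF : MDifferentiableAt (𝓡 4) (𝓡 4) F ((chartAt E4 x).symm y))
    (hy' : F ((chartAt E4 x).symm y) ∈ (chartAt E4 x').source)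
    (hG : MDifferentiableAt (𝓡 4) (𝓡 4) G (F ((chartAt E4 x).symm y))) :
    𝓢.metricInCoords ((G ∘ F) ∘ (chartAt E4 x).symm) y - 𝓤.metricInCoords (chartAt E4 x).symm y =
      bilinPullback (chartTransition F x x')
          (𝓢.metricInCoords (G ∘ (chartAt E4 x').symm) - 𝓣.metricInCoords (chartAt E4 x').symm) y +
        (𝓣.metricInCoords (F ∘ (chartAt E4 x).symm) y - 𝓤.metricInCoords (chartAt E4 x).symm y) := by
  have hθ : DifferentiableAt ℝ (chartTransition F x x') y :=
    differentiableAt_chartTransition hy hF hy'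
  have hθy : chartTransition F x x' y = chartAt E4 x' (F ((chartAt E4 x).symm y)) := rfl
  have hsymm : MDifferentiableAt 𝓘(ℝ, E4) (𝓡 4) (chartAt E4 x').symm (chartTransition F x x' y) :=
    mdifferentiableAt_atlas_symm (chart_mem_atlas E4 x') ((chartAt E4 x').map_source hy')
  have hGsymm : MDifferentiableAt 𝓘(ℝ, E4) (𝓡 4) (G ∘ (chartAt E4 x').symm)
      (chartTransition F x x' y) := by
    refine MDifferentiableAt.comp _ ?_ hsymm
    rw [hθy, (chartAt E4 x').left_inv hy']
    exact hG
  have h1 : 𝓢.metricInCoords ((G ∘ F) ∘ (chartAt E4 x).symm) y =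
      bilinPullback (chartTransition F x x') (𝓢.metricInCoords (G ∘ (chartAt E4 x').symm)) y :=
    𝓢.metricInCoords_eq_bilinPullback_of_eventuallyEq
      (comp_comp_symm_eventuallyEq hy hF.continuousAt hy') hGsymm hθ
  have h2 : 𝓣.metricInCoords (F ∘ (chartAt E4 x).symm) y =
      bilinPullback (chartTransition F x x') (𝓣.metricInCoords (chartAt E4 x').symm) y :=
    𝓣.metricInCoords_eq_bilinPullback_of_eventuallyEq
      (comp_symm_eventuallyEq_symm_comp_chartTransition hy hF.continuousAt hy') hsymm hθ
  rw [bilinPullback_sub_apply, h1, h2]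
  abel

/-- **The first bracket alone**: under the same hypotheses, the deviation of the composite
`G ∘ F` from the middle space `𝓣`, read in the chart `c` of `𝓤`, is the transported deviation of
`G`: `(G∘F∘c⁻¹)^* g_𝓢 − (F∘c⁻¹)^* g_𝓣 = θ^*[(G∘c'⁻¹)^* g_𝓢 − (c'⁻¹)^* g_𝓣]` at `y`.
[cite: Petersen2006, Ch. 10 §3.2] -/
theorem metricInCoords_comp_comp_sub_metricInCoords_comp_eq {G : 𝓣.carrier → 𝓢.carrier}
    {F : 𝓤.carrier → 𝓣.carrier} {x : 𝓤.carrier} {x' : 𝓣.carrier} {y : E4}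
    (hy : y ∈ (chartAt E4 x).target)
    (hF : MDifferentiableAt (𝓡 4) (𝓡 4) F ((chartAt E4 x).symm y))
    (hy' : F ((chartAt E4 x).symm y) ∈ (chartAt E4 x').source)
    (hG : MDifferentiableAt (𝓡 4) (𝓡 4) G (F ((chartAt E4 x).symm y))) :
    𝓢.metricInCoords ((G ∘ F) ∘ (chartAt E4 x).symm) y -
        𝓣.metricInCoords (F ∘ (chartAt E4 x).symm) y =
      bilinPullback (chartTransition F x x')
        (𝓢.metricInCoords (G ∘ (chartAt E4 x').symm) - 𝓣.metricInCoords (chartAt E4 x').symm) y := by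
  have hθ : DifferentiableAt ℝ (chartTransition F x x') y :=
    differentiableAt_chartTransition hy hF hy'
  have hθy : chartTransition F x x' y = chartAt E4 x' (F ((chartAt E4 x).symm y)) := rfl
  have hsymm : MDifferentiableAt 𝓘(ℝ, E4) (𝓡 4) (chartAt E4 x').symm (chartTransition F x x' y) :=
    mdifferentiableAt_atlas_symm (chart_mem_atlas E4 x') ((chartAt E4 x').map_source hy')
  have hGsymm : MDifferentiableAt 𝓘(ℝ, E4) (𝓡 4) (G ∘ (chartAt E4 x').symm)
      (chartTransition F x x' y) := by
    refine MDifferentiableAt.comp _ ?_ hsymm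
    rw [hθy, (chartAt E4 x').left_inv hy']
    exact hG
  have h1 : 𝓢.metricInCoords ((G ∘ F) ∘ (chartAt E4 x).symm) y =
      bilinPullback (chartTransition F x x') (𝓢.metricInCoords (G ∘ (chartAt E4 x').symm)) y :=
    𝓢.metricInCoords_eq_bilinPullback_of_eventuallyEq
      (comp_comp_symm_eventuallyEq hy hF.continuousAt hy') hGsymm hθ
  have h2 : 𝓣.metricInCoords (F ∘ (chartAt E4 x).symm) y =
      bilinPullback (chartTransition F x x') (𝓣.metricInCoords (chartAt E4 x').symm) y :=
    𝓣.metricInCoords_eq_bilinPullback_of_eventuallyEq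
      (comp_symm_eventuallyEq_symm_comp_chartTransition hy hF.continuousAt hy') hsymm hθ
  rw [bilinPullback_sub_apply, h1, h2]

end TwoCharts

end Spacetime

end Literature.Geometry.Lorentzian
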